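import Literature.Probability.Distributions.GaussianMoments
import Mathlib.Probability.Distributions.Gaussian.HasGaussianLaw.Basic
import HarnessLib

/-!
# Route `TypicalExteriorCeilings`, crux `AnnealedBoundaryLaw` (stmt-QuantumFields-25891; split V stmt-25920 / M stmt-25921) — BC5 rung α, part 1/2:
# the WICK SQUARE of a centred Gaussian (`X² − E X²`): exact variance `2(EX²)²`, moments `≤ (8p·EX²)^p`, moment comparability with `κ = 1`

Helper file (`--supports stmt-QuantumFields-25891`) of the tribunal-w (bc5-witness) seat `ym-tec-bc5w-1` (g0); theorems only, no definitions,
no sorry.  Part 2 (`TypicalExteriorCeilingsAnnealedBoundaryLawGaussianRung`) applies these to the exterior response of the lattice free field of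
`ℤ⁴` — the free-Maxwell / lattice-Gaussian instance of the conclusions of the cruxes V (`VarianceBoundaryLaw`), M (`MomentComparability`,
`κ = 1`) and K1 (`AnnealedBoundaryLaw`, `κ = 1`).  NOTHING here bears on the Yang–Mills mass gap, the route's leaf (stmt-19868), `NT`, or the
cruxes themselves (statements about the SU(2) Wilson state under live floors); this part is one-dimensional Gaussian calculus.

Contents: §0 arithmetic (`(2p−1)!! ≤ (2p)^p`); §1 for `γ_v = 𝒩(0,v)`: `∫(t²−v)² dγ_v = 2v²` and
`∫|t²−v|^p dγ_v ≤ (8pv)^p` (`p ≥ 1`; from `E t^{2p} = v^p(2p−1)!! ≤ (2pv)^p` — the order-2 Wiener-chaos growth `‖·‖_p ≲ p`, i.e. the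
hypercontractivity exponent `κ = 1`, obtained here by explicit moments rather than Bonami's inequality); §2 transport to any centred Gaussian `X`
on a probability space (`HasGaussianLaw X P`, `∫X = 0`): V `∫|X² − ∫X²|² = 2(∫X²)²`, K1 `∫|X² − ∫X²|^p ≤ (8p∫X²)^p`,
M `(∫|X² − ∫X²|^p)² ≤ (6p)^{2p}(∫|X² − ∫X²|²)^p`.
References: S. Janson, *Gaussian Hilbert Spaces* (1997), Rem. 1.30, Thm. 5.10 [Janson1997].
-/

set_option autoImplicit false

noncomputable section

open MeasureTheory ProbabilityTheory Finset
open scoped NNReal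
open Literature.Probability.Distributions

namespace Summit.QuantumFields.YangMills.Cruxes.AnnealedBoundaryLaw.GaussianRung


/-! ## §0 Arithmetic -/

/-- `(2q+1)!! ≤ (2q+2)^(q+1)`. [folklore] -/
theorem doubleFactorial_odd_le (q : ℕ) : Nat.doubleFactorial (2 * q + 1) ≤ (2 * q + 2) ^ (q + 1) := by
  induction q with
  | zero => decide
  | succ q ih =>
    rw [show 2 * (q + 1) + 1 = (2 * q + 1) + 2 by ring, Nat.doubleFactorial_add_two,
      show 2 * (q + 1) + 2 = 2 * q + 4 by ring, pow_succ]
    calc (2 * q + 1 + 2) * Nat.doubleFactorial (2 * q + 1) ≤ (2 * q + 4) * (2 * q + 2) ^ (q + 1) :=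
          Nat.mul_le_mul (by omega) ih
      _ ≤ (2 * q + 4) * (2 * q + 4) ^ (q + 1) := Nat.mul_le_mul_left _ (Nat.pow_le_pow_left (by omega) _)
      _ = (2 * q + 4) ^ (q + 1) * (2 * q + 4) := Nat.mul_comm _ _

/-- `(2p−1)!! ≤ (2p)^p` for `p ≥ 1` (real-cast form). [folklore] -/
theorem cast_doubleFactorial_le {p : ℕ} (hp : 1 ≤ p) : ((Nat.doubleFactorial (2 * p - 1) : ℕ) : ℝ) ≤ (2 * (p : ℝ)) ^ p := by
  obtain ⟨q, rfl⟩ : ∃ q, p = q + 1 := ⟨p - 1, by omega⟩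
  rw [show 2 * (q + 1) - 1 = 2 * q + 1 by omega]
  have h := doubleFactorial_odd_le q
  calc ((Nat.doubleFactorial (2 * q + 1) : ℕ) : ℝ) ≤ ((2 * q + 2) ^ (q + 1) : ℕ) := by exact_mod_cast h
    _ = (2 * ((q + 1 : ℕ) : ℝ)) ^ (q + 1) := by push_cast; ring

/-! ## §1 The Wick square of a one-dimensional centred Gaussian -/

/-- **Variance of the Wick square**: `∫ (t² − v)² d𝒩(0,v) = 2v²` (`E t⁴ = 3v²`, `E t² = v`). [cite: Janson1997, Rem. 1.30] -/
theorem integral_sq_sub_var_sq_gaussianReal (v : ℝ≥0) :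
    ∫ t, (t ^ 2 - (v : ℝ)) ^ 2 ∂(gaussianReal 0 v) = 2 * (v : ℝ) ^ 2 := by
  have i4 : Integrable (fun t : ℝ => t ^ 4) (gaussianReal 0 v) := integrable_pow_gaussianReal 0 v 4
  have i2 : Integrable (fun t : ℝ => 2 * (v : ℝ) * t ^ 2) (gaussianReal 0 v) :=
    (integrable_pow_gaussianReal 0 v 2).const_mul _
  have h4 : ∫ t, t ^ 4 ∂(gaussianReal 0 v) = 3 * (v : ℝ) ^ 2 := by
    have h := integral_pow_even_gaussianReal v 2
    have h3 : Nat.doubleFactorial (2 * 2 - 1) = 3 := by decide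
    rw [h3, show 2 * 2 = 4 from rfl] at h
    rw [h]; push_cast; ring
  have h2 : ∫ t, t ^ 2 ∂(gaussianReal 0 v) = (v : ℝ) := by
    have h := integral_pow_even_gaussianReal v 1
    have h1 : Nat.doubleFactorial (2 * 1 - 1) = 1 := by decide
    rw [h1, show 2 * 1 = 2 from rfl] at h
    rw [h]; push_cast; ring
  have hexp : (fun t : ℝ => (t ^ 2 - (v : ℝ)) ^ 2) = fun t => (t ^ 4 - 2 * (v : ℝ) * t ^ 2) + (v : ℝ) ^ 2 := by
    funext t; ring
  have i42 : Integrable (fun t : ℝ => t ^ 4 - 2 * (v : ℝ) * t ^ 2) (gaussianReal 0 v) := i4.sub i2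
  rw [hexp, integral_add i42 (integrable_const _), integral_sub i4 i2, integral_const_mul, integral_const,
    probReal_univ, one_smul, h4, h2]
  ring

/-- **Moments of the Wick square**: `∫ |t² − v|^p d𝒩(0,v) ≤ (8pv)^p` for `p ≥ 1` — from `|t² − v|^p ≤ 2^p(t^{2p} + v^p)` and the even Gaussian
moments `∫ t^{2p} = v^p (2p−1)‼ ≤ (2pv)^p`; the order-2 Wiener-chaos growth `‖·‖_p ≲ p` (hypercontractivity exponent `κ = 1`).
[cite: Janson1997, Rem. 1.30, Thm. 5.10] -/
theorem integral_abs_sq_sub_pow_le_gaussianReal (v : ℝ≥0) {p : ℕ} (hp : 1 ≤ p) :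
    ∫ t, |t ^ 2 - (v : ℝ)| ^ p ∂(gaussianReal 0 v) ≤ (8 * p * (v : ℝ)) ^ p := by
  have hv : 0 ≤ (v : ℝ) := v.coe_nonneg
  -- `(a + b)^p ≤ 2^p (a^p + b^p)` for `a, b ≥ 0` (cf. `Literature.NumberTheory.LFunctions.add_pow_le_two_pow`; inlined to keep the
  -- import closure of this probability file free of L-function theory)
  have add_pow_le : ∀ {a b : ℝ}, 0 ≤ a → 0 ≤ b → (a + b) ^ p ≤ 2 ^ p * (a ^ p + b ^ p) := by
    intro a b ha hb
    have h1 : a + b ≤ 2 * max a b := by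
      rcases le_total a b with h | h
      · rw [max_eq_right h]; linarith
      · rw [max_eq_left h]; linarith
    have h2 : (max a b) ^ p ≤ a ^ p + b ^ p := by
      rcases le_total a b with h | h
      · rw [max_eq_right h]; linarith [pow_nonneg ha p]
      · rw [max_eq_left h]; linarith [pow_nonneg hb p]
    calc (a + b) ^ p ≤ (2 * max a b) ^ p := pow_le_pow_left₀ (add_nonneg ha hb) h1 p
      _ = 2 ^ p * (max a b) ^ p := mul_pow _ _ _
      _ ≤ 2 ^ p * (a ^ p + b ^ p) := mul_le_mul_of_nonneg_left h2 (pow_nonneg zero_le_two p)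
  have hdom : ∀ t : ℝ, |t ^ 2 - (v : ℝ)| ^ p ≤ 2 ^ p * (t ^ (2 * p) + (v : ℝ) ^ p) := fun t => by
    have h1 : |t ^ 2 - (v : ℝ)| ≤ t ^ 2 + (v : ℝ) := by
      rw [abs_le]; constructor <;> nlinarith [sq_nonneg t, hv]
    calc |t ^ 2 - (v : ℝ)| ^ p ≤ (t ^ 2 + (v : ℝ)) ^ p := pow_le_pow_left₀ (abs_nonneg _) h1 p
      _ ≤ 2 ^ p * ((t ^ 2) ^ p + (v : ℝ) ^ p) := add_pow_le (sq_nonneg t) hv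
      _ = 2 ^ p * (t ^ (2 * p) + (v : ℝ) ^ p) := by rw [← pow_mul]
  have hg : Integrable (fun t : ℝ => 2 ^ p * (t ^ (2 * p) + (v : ℝ) ^ p)) (gaussianReal 0 v) :=
    ((integrable_pow_gaussianReal 0 v (2 * p)).add (integrable_const _)).const_mul _
  have hf : Integrable (fun t : ℝ => |t ^ 2 - (v : ℝ)| ^ p) (gaussianReal 0 v) :=
    hg.mono' (Continuous.aestronglyMeasurable (by fun_prop)) (ae_of_all _ fun t => by
      rw [Real.norm_eq_abs, abs_of_nonneg (pow_nonneg (abs_nonneg _) p)]; exact hdom t)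
  have hdf : ((Nat.doubleFactorial (2 * p - 1) : ℕ) : ℝ) ≤ (2 * (p : ℝ)) ^ p := cast_doubleFactorial_le hp
  have hp1 : (1 : ℝ) ≤ p := by exact_mod_cast hp
  have h1p : (1 : ℝ) ≤ (2 * (p : ℝ)) ^ p := one_le_pow₀ (by linarith)
  have hvp : 0 ≤ (v : ℝ) ^ p := pow_nonneg hv p
  have h2p : (2 : ℝ) ≤ 2 ^ p := by
    calc (2 : ℝ) = 2 ^ 1 := (pow_one _).symm
      _ ≤ 2 ^ p := pow_le_pow_right₀ one_le_two hp
  calc ∫ t, |t ^ 2 - (v : ℝ)| ^ p ∂(gaussianReal 0 v)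
      ≤ ∫ t, 2 ^ p * (t ^ (2 * p) + (v : ℝ) ^ p) ∂(gaussianReal 0 v) := integral_mono hf hg hdom
    _ = 2 ^ p * ((v : ℝ) ^ p * ((Nat.doubleFactorial (2 * p - 1) : ℕ) : ℝ) + (v : ℝ) ^ p) := by
        rw [integral_const_mul, integral_add (integrable_pow_gaussianReal 0 v (2 * p)) (integrable_const _),
          integral_pow_even_gaussianReal, integral_const, probReal_univ, one_smul]
    _ ≤ 2 ^ p * ((v : ℝ) ^ p * (2 * (p : ℝ)) ^ p + (v : ℝ) ^ p * (2 * (p : ℝ)) ^ p) :=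
        mul_le_mul_of_nonneg_left (add_le_add (mul_le_mul_of_nonneg_left hdf hvp)
          (le_mul_of_one_le_right hvp h1p)) (pow_nonneg zero_le_two p)
    _ = 2 * (2 ^ p * ((2 * (p : ℝ)) ^ p * (v : ℝ) ^ p)) := by ring
    _ ≤ 2 ^ p * (2 ^ p * ((2 * (p : ℝ)) ^ p * (v : ℝ) ^ p)) := mul_le_mul_of_nonneg_right h2p (by positivity)
    _ = (8 * p * (v : ℝ)) ^ p := by
        rw [show (8 * p * (v : ℝ)) = 2 * (2 * ((2 * (p : ℝ)) * v)) by ring]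
        simp only [mul_pow]

/-! ## §2 Transport to a centred Gaussian on any probability space -/

section Transport

variable {Ω : Type*} [MeasurableSpace Ω] {P : Measure Ω} {X : Ω → ℝ}

/-- A centred Gaussian `X` with `∫X² = s` has law `𝒩(0, s)`: `∫ f(X) dP = ∫ f d𝒩(0,s)` for continuous `f`. [folklore] -/
theorem integral_comp_eq_of_hasGaussianLaw (hX : HasGaussianLaw X P) (h0 : ∫ ω, X ω ∂P = 0) {f : ℝ → ℝ}
    (hf : Continuous f) :
    ∫ ω, f (X ω) ∂P = ∫ t, f t ∂(gaussianReal 0 (∫ ω, (X ω) ^ 2 ∂P).toNNReal) := by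
  have hvar : Var[X; P] = ∫ ω, (X ω) ^ 2 ∂P := by
    rw [variance_of_integral_eq_zero hX.aemeasurable h0]
  have hlaw : P.map X = gaussianReal 0 (∫ ω, (X ω) ^ 2 ∂P).toNNReal := by
    rw [hX.map_eq_gaussianReal, h0, hvar]
  rw [← hlaw, integral_map hX.aemeasurable hf.aestronglyMeasurable]

/-- **V in the Gaussian model (exact)**: for a centred Gaussian `X`, `∫ |X² − ∫X²|² = 2 (∫X²)²`. [cite: Janson1997, Rem. 1.30] -/
theorem integral_wickSq_sq_eq (hX : HasGaussianLaw X P) (h0 : ∫ ω, X ω ∂P = 0) :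
    ∫ ω, |(X ω) ^ 2 - ∫ ω', (X ω') ^ 2 ∂P| ^ 2 ∂P = 2 * (∫ ω, (X ω) ^ 2 ∂P) ^ 2 := by
  have hs0 : 0 ≤ ∫ ω, (X ω) ^ 2 ∂P := integral_nonneg fun ω => sq_nonneg _
  have h := integral_comp_eq_of_hasGaussianLaw hX h0 (f := fun t => |t ^ 2 - ∫ ω, (X ω) ^ 2 ∂P| ^ 2) (by fun_prop)
  beta_reduce at h
  rw [h]
  have h1 := integral_sq_sub_var_sq_gaussianReal (∫ ω, (X ω) ^ 2 ∂P).toNNReal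
  rw [Real.coe_toNNReal _ hs0] at h1
  simp_rw [sq_abs]
  exact h1

/-- **K1 in the Gaussian model**: for a centred Gaussian `X` and `p ≥ 1`, `∫ |X² − ∫X²|^p ≤ (8p·∫X²)^p` (`κ = 1`). [cite: Janson1997, Thm. 5.10] -/
theorem integral_wickSq_abs_pow_le (hX : HasGaussianLaw X P) (h0 : ∫ ω, X ω ∂P = 0) {p : ℕ} (hp : 1 ≤ p) :
    ∫ ω, |(X ω) ^ 2 - ∫ ω', (X ω') ^ 2 ∂P| ^ p ∂P ≤ (8 * p * ∫ ω, (X ω) ^ 2 ∂P) ^ p := by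
  have hs0 : 0 ≤ ∫ ω, (X ω) ^ 2 ∂P := integral_nonneg fun ω => sq_nonneg _
  have h := integral_comp_eq_of_hasGaussianLaw hX h0 (f := fun t => |t ^ 2 - ∫ ω, (X ω) ^ 2 ∂P| ^ p) (by fun_prop)
  beta_reduce at h
  rw [h]
  have h1 := integral_abs_sq_sub_pow_le_gaussianReal (∫ ω, (X ω) ^ 2 ∂P).toNNReal hp
  rw [Real.coe_toNNReal _ hs0] at h1
  exact h1

/-- **M in the Gaussian model (moment comparability, `κ = 1`)**: for a centred Gaussian `X` and `p ≥ 1`,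
`(∫ |X² − ∫X²|^p)² ≤ (6p)^{2p} (∫ |X² − ∫X²|²)^p`. [cite: Janson1997, Thm. 5.10] -/
theorem wickSq_momentComparability (hX : HasGaussianLaw X P) (h0 : ∫ ω, X ω ∂P = 0) {p : ℕ} (hp : 1 ≤ p) :
    (∫ ω, |(X ω) ^ 2 - ∫ ω', (X ω') ^ 2 ∂P| ^ p ∂P) ^ 2 ≤
      (6 * (p : ℝ)) ^ (2 * p) * (∫ ω, |(X ω) ^ 2 - ∫ ω', (X ω') ^ 2 ∂P| ^ 2 ∂P) ^ p := by
  have hK := integral_wickSq_abs_pow_le hX h0 hp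
  have hV := integral_wickSq_sq_eq hX h0
  set s : ℝ := ∫ ω, (X ω) ^ 2 ∂P with hs
  have hI0 : 0 ≤ ∫ ω, |(X ω) ^ 2 - s| ^ p ∂P := integral_nonneg fun ω => pow_nonneg (abs_nonneg _) p
  rw [hV]
  calc (∫ ω, |(X ω) ^ 2 - s| ^ p ∂P) ^ 2 ≤ ((8 * p * s) ^ p) ^ 2 := pow_le_pow_left₀ hI0 hK 2
    _ = ((8 * p * s) ^ 2) ^ p := pow_right_comm _ _ _
    _ ≤ ((6 * (p : ℝ)) ^ 2 * (2 * s ^ 2)) ^ p :=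
        pow_le_pow_left₀ (sq_nonneg _) (by nlinarith [sq_nonneg ((p : ℝ) * s)]) p
    _ = (6 * (p : ℝ)) ^ (2 * p) * (2 * s ^ 2) ^ p := by rw [mul_pow, ← pow_mul]

end Transport

end Summit.QuantumFields.YangMills.Cruxes.AnnealedBoundaryLaw.GaussianRung

end
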